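import Literature.Combinatorics.Hypergraph.FGKMTCoveringNibble
import HarnessLib

/-!
# Ford–Green–Konyagin–Maynard–Tao 2018, §5: one nibble — the `Y`-sandwich and the moments (5.7)–(5.8)

Topic `Literature/Combinatorics/Hypergraph`. Source: K. Ford, B. Green, S. Konyagin, J. Maynard, T. Tao,
*Long gaps between primes*, J. Amer. Math. Soc. 31 (2018) 65–105 = arXiv:1412.5029
[FordGreenKonyaginMaynardTao2018], §5 «Proof of covering theorem», pp. 20–21 (arXiv pp. 15–16):
the part of the inductive step from (5.6) to the display after (5.8).

For a nibble `𝔑 : NibbleData` (see `FGKMTCoveringNibble`) and a fixed set `e` with `#e ≤ s`, this file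
PROVES, with explicit constants:
* the sandwich `exp(−(1+2α) S_e(W)) ≤ Y_e(W) ≤ exp(−S_e(W) + γ)` for the conditional avoidance
  probability `Y_e(W) = ∏_{i∈I_m} P(e ∩ 𝐞'_i = ∅ | 𝐖 = W) = ∏_i (1 − π_i)` in terms of
  `S_e(W) = ∑_i E(#(e ∩ 𝐞'_i) | 𝐖 = W)`, where `α = 2κ^{-r}sδ ≥ π_i` and `γ = 2κ^{-r}s²δ` bounds the
  pair-correction `∑_i E(#(e∩𝐞'_i) − 1_{e∩𝐞'_i≠∅})` via the codegree hypothesis (4.8);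
* `|S_e(W) − ∑_{v∈e} M_v(W)| ≤ ∑_{v∈e} Err_v(W)` with `M_v(W) = ∑_i ∑_{S∋v, S⊆W} P(𝐞_i=S)/P_{m−1}(S)`
  (display (5.6)) and `E Err_v(𝐖) ≤ κ^{-r}(2t + φ)D` (Lemma 5.1);
* the first and second moments (5.7), (5.8): `E 1_{e'⊆𝐖} M_v(𝐖) = (1 + O_≤(η)) P(e')/p(v) · (d(v) + O_≤(κ^{-r}#e'δ))`
  for `#e' ≤ s + r`, and `E 1_{e⊆𝐖} M_v(𝐖)² ≤ (1+η) P(e)/p(v)² (d + κ^{-r}sδ)(d + κ^{-r}(s+r)δ)`;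
* the variance bound `E 1_{e⊆𝐖}(M_v(𝐖) − d(v)/p(v))² ≤ P(e) ζ` with
  `ζ = 4ηD² + 2κ^{-3r}δD(2s+r) + 2κ^{-4r}δ²s(s+r)`.
-/

noncomputable section

open Finset

namespace Literature.Combinatorics.Hypergraph

namespace FGKMTCovering

namespace NibbleData

variable {V ι Ω : Type*} [Fintype V] [DecidableEq V] [Fintype Ω] (𝔑 : NibbleData V ι Ω)

/-! ### Domination of the conditional laws by the original ones -/

/-- `∑_S q_i(S | W) g(S) ≤ 2κ^{-r} ∑_S P(𝐞_i = S) g(S)` for `g ≥ 0` with `g(∅) = 0`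
(«`P(v ∈ 𝐞'_i | 𝐖 = W) ≪ κ^{-r} P(v ∈ 𝐞_i)`», uniformly in `i, W`).
[cite: FordGreenKonyaginMaynardTao2018, §5 (display after (5.3))] -/
theorem sum_q_mul_le {i : ι} (hi : i ∈ 𝔑.T) (W : Finset V) {g : Finset V → ℝ}
    (hg : ∀ S, 0 ≤ g S) (hg0 : g ∅ = 0) :
    ∑ S, 𝔑.q W i S * g S ≤ 2 * 𝔑.θ⁻¹ * ∑ S, 𝔑.μ i S * g S := by
  have hθi : 0 ≤ 𝔑.θ⁻¹ := inv_nonneg.2 𝔑.hθ0.le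
  by_cases hF : |𝔑.X i W - 1| ≤ 𝔑.t
  · rw [Finset.mul_sum]
    exact Finset.sum_le_sum fun S _ =>
      calc 𝔑.q W i S * g S ≤ 2 * 𝔑.θ⁻¹ * 𝔑.μ i S * g S :=
            mul_le_mul_of_nonneg_right (𝔑.q_le hi hF S) (hg S)
        _ = 2 * 𝔑.θ⁻¹ * (𝔑.μ i S * g S) := by ring
  · simp_rw [𝔑.q_of_not_F hF]
    have h : ∑ S, (if S = ∅ then (1 : ℝ) else 0) * g S = g ∅ := by
      simp [ite_mul]
    rw [h, hg0]
    exact mul_nonneg (mul_nonneg (by norm_num) hθi)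
      (Finset.sum_nonneg fun S _ => mul_nonneg (𝔑.μ_nonneg hi S) (hg S))

/-! ### The sifting step for a fixed set `e`: `π_i`, `S_e`, `Y` -/

section FixedSet

variable (e : Finset V)

/-- `π_i(W) := P(e ∩ 𝐞'_i ≠ ∅ | 𝐖 = W)`. [cite: FordGreenKonyaginMaynardTao2018, §5 (factorisation of `Y(W)`)] -/
def π (W : Finset V) (i : ι) : ℝ := ∑ S, if (S ∩ e).Nonempty then 𝔑.q W i S else 0

/-- `S_e(W) := ∑_{i ∈ I_m} E(#(e ∩ 𝐞'_i) | 𝐖 = W)`.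
[cite: FordGreenKonyaginMaynardTao2018, §5 (display defining `Y(W) = (1 + O(…)) exp(−∑ E #(e ∩ 𝐞'_i)|…)`)] -/
def Se (W : Finset V) : ℝ := ∑ i ∈ 𝔑.T, ∑ S, 𝔑.q W i S * #(S ∩ e)

/-- `Y(W) := P(e ⊆ 𝐖' | 𝐖 = W) = ∏_{i ∈ I_m} P(e ∩ 𝐞'_i = ∅ | 𝐖 = W)` (conditional independence).
[cite: FordGreenKonyaginMaynardTao2018, §5 (definition and factorisation of `Y(W)`)] -/
def Y (W : Finset V) : ℝ := ∏ i ∈ 𝔑.T, ∑ S, if (S ∩ e).Nonempty then 0 else 𝔑.q W i S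

/-- The bound `α = 2κ^{-r} s δ ≥ π_i(W)`. [cite: FordGreenKonyaginMaynardTao2018, §5 («`P(e ∩ 𝐞'_i ≠ ∅ | 𝐖 = W) ≪ …`»)] -/
def α : ℝ := 2 * 𝔑.θ⁻¹ * 𝔑.s * 𝔑.δ

/-- The inclusion–exclusion loss `γ = 2κ^{-r} s² δ`. [cite: FordGreenKonyaginMaynardTao2018, §5 (inclusion–exclusion)] -/
def γ : ℝ := 2 * 𝔑.θ⁻¹ * 𝔑.s ^ 2 * 𝔑.δ

variable {e}

/-- [cite: FordGreenKonyaginMaynardTao2018, §5 (factorisation of `Y(W)`)] -/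
theorem π_eq (W : Finset V) (i : ι) :
    𝔑.π e W i = ∑ S, 𝔑.q W i S * (if (S ∩ e).Nonempty then 1 else 0) :=
  Finset.sum_congr rfl fun S _ => by split_ifs <;> simp

/-- [cite: FordGreenKonyaginMaynardTao2018, §5 (factorisation of `Y(W)`)] -/
theorem π_nonneg {i : ι} (hi : i ∈ 𝔑.T) (W : Finset V) : 0 ≤ 𝔑.π e W i :=
  Finset.sum_nonneg fun S _ => by
    split_ifs
    · exact 𝔑.q_nonneg hi W S
    · exact le_rfl

/-- `π_i(W) ≤ E(#(e ∩ 𝐞'_i) | W)`. [cite: FordGreenKonyaginMaynardTao2018, §5 (union bound)] -/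
theorem π_le_sum_card {i : ι} (hi : i ∈ 𝔑.T) (W : Finset V) :
    𝔑.π e W i ≤ ∑ S, 𝔑.q W i S * #(S ∩ e) := by
  rw [π_eq]
  refine Finset.sum_le_sum fun S _ => mul_le_mul_of_nonneg_left ?_ (𝔑.q_nonneg hi W S)
  split_ifs with h
  · exact_mod_cast h.card_pos
  · exact Nat.cast_nonneg _

/-- `E(#(e ∩ 𝐞'_i) | W) ≤ 2κ^{-r} ∑_{v ∈ e} P(v ∈ 𝐞_i)`.
[cite: FordGreenKonyaginMaynardTao2018, §5 (display after (5.3), union bound)] -/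
theorem sum_q_card_le {i : ι} (hi : i ∈ 𝔑.T) (W : Finset V) :
    ∑ S, 𝔑.q W i S * #(S ∩ e) ≤ 2 * 𝔑.θ⁻¹ * ∑ v ∈ e, probMem (𝔑.μ i) v := by
  rw [← sum_mul_card_inter]
  exact 𝔑.sum_q_mul_le hi W (fun S => Nat.cast_nonneg _) (by simp)

/-- [cite: FordGreenKonyaginMaynardTao2018, (4.5)] -/
theorem α_nonneg : 0 ≤ 𝔑.α :=
  mul_nonneg (mul_nonneg (mul_nonneg (by norm_num) (inv_nonneg.2 𝔑.hθ0.le)) 𝔑.hs) 𝔑.hδ.le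

/-- [cite: FordGreenKonyaginMaynardTao2018, (4.5)] -/
theorem α_le : 𝔑.α ≤ 2 * 𝔑.G ^ 2 * 𝔑.η := by
  unfold α
  have h1 : 𝔑.θ⁻¹ * 𝔑.s ≤ 𝔑.G * 𝔑.G :=
    mul_le_mul 𝔑.hθG 𝔑.hsG 𝔑.hs (le_trans zero_le_one 𝔑.hG)
  have h2 := 𝔑.δ_le_η
  calc 2 * 𝔑.θ⁻¹ * 𝔑.s * 𝔑.δ = 2 * (𝔑.θ⁻¹ * 𝔑.s) * 𝔑.δ := by ring
    _ ≤ 2 * (𝔑.G * 𝔑.G) * 𝔑.η := by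
        refine mul_le_mul (mul_le_mul_of_nonneg_left h1 (by norm_num)) h2 𝔑.hδ.le ?_
        nlinarith [𝔑.hG]
    _ = 2 * 𝔑.G ^ 2 * 𝔑.η := by ring

/-- [cite: FordGreenKonyaginMaynardTao2018, (4.5)] -/
theorem α_le_half : 𝔑.α ≤ 1 / 2 := by
  have := 𝔑.Gsqη_le
  linarith [𝔑.α_le]

/-- `π_i(W) ≤ α = 2κ^{-r} s δ` for `#e ≤ s` («`P(e ∩ 𝐞'_i ≠ ∅ | 𝐖 = W) ≪ …` by (4.7)»).
[cite: FordGreenKonyaginMaynardTao2018, §5 (display after (5.3))] -/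
theorem π_le_α {i : ι} (hi : i ∈ 𝔑.T) (W : Finset V) (he : (#e : ℝ) ≤ 𝔑.s) : 𝔑.π e W i ≤ 𝔑.α := by
  refine ((𝔑.π_le_sum_card hi W).trans (𝔑.sum_q_card_le hi W)).trans ?_
  have hθi : 0 ≤ 𝔑.θ⁻¹ := inv_nonneg.2 𝔑.hθ0.le
  have h : ∑ v ∈ e, probMem (𝔑.μ i) v ≤ 𝔑.s * 𝔑.δ :=
    calc ∑ v ∈ e, probMem (𝔑.μ i) v ≤ ∑ _v ∈ e, 𝔑.δ := Finset.sum_le_sum fun v _ => 𝔑.hsparse i hi v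
      _ = #e * 𝔑.δ := by rw [Finset.sum_const, nsmul_eq_mul]
      _ ≤ 𝔑.s * 𝔑.δ := mul_le_mul_of_nonneg_right he 𝔑.hδ.le
  unfold α
  nlinarith [mul_le_mul_of_nonneg_left h hθi]

/-- The conditional-independence factorisation `Y(W) = ∏_i (1 − π_i(W))`.
[cite: FordGreenKonyaginMaynardTao2018, §5 (factorisation of `Y(W)`)] -/
theorem Y_eq_prod (W : Finset V) : 𝔑.Y e W = ∏ i ∈ 𝔑.T, (1 - 𝔑.π e W i) := by
  refine Finset.prod_congr rfl fun i _ => ?_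
  have h : ∀ S : Finset V, (if (S ∩ e).Nonempty then (0 : ℝ) else 𝔑.q W i S) =
      𝔑.q W i S - (if (S ∩ e).Nonempty then 𝔑.q W i S else 0) := by
    intro S; split_ifs <;> ring
  simp_rw [h]
  rw [Finset.sum_sub_distrib, 𝔑.q_sum]
  rfl

/-- `∑_i π_i(W) ≤ S_e(W)` (union bound). [cite: FordGreenKonyaginMaynardTao2018, §5 (inclusion–exclusion)] -/
theorem sum_π_le_Se (W : Finset V) : ∑ i ∈ 𝔑.T, 𝔑.π e W i ≤ 𝔑.Se e W :=
  Finset.sum_le_sum fun _ hi => 𝔑.π_le_sum_card hi W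

/-- [cite: FordGreenKonyaginMaynardTao2018, §5] -/
theorem Se_nonneg (W : Finset V) : 0 ≤ 𝔑.Se e W :=
  Finset.sum_nonneg fun _ hi => Finset.sum_nonneg fun S _ =>
    mul_nonneg (𝔑.q_nonneg hi W S) (Nat.cast_nonneg _)

/-- [cite: FordGreenKonyaginMaynardTao2018, (4.5)] -/
theorem γ_nonneg : 0 ≤ 𝔑.γ :=
  mul_nonneg (mul_nonneg (mul_nonneg (by norm_num) (inv_nonneg.2 𝔑.hθ0.le)) (sq_nonneg _)) 𝔑.hδ.le

/-- **Inclusion–exclusion:** `S_e(W) ≤ ∑_i π_i(W) + γ`, `γ = 2κ^{-r}s²δ` («from (4.8) the pair terms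
contribute `O(…δ)`»). [cite: FordGreenKonyaginMaynardTao2018, §5 (inclusion–exclusion via (4.8))] -/
theorem Se_le_sum_π_add (W : Finset V) (he : (#e : ℝ) ≤ 𝔑.s) :
    𝔑.Se e W ≤ ∑ i ∈ 𝔑.T, 𝔑.π e W i + 𝔑.γ := by
  have hθi : 0 ≤ 𝔑.θ⁻¹ := inv_nonneg.2 𝔑.hθ0.le
  -- the pair-count function
  set g : Finset V → ℝ := fun S => ∑ v ∈ e, ∑ w ∈ e.erase v, (if v ∈ S ∧ w ∈ S then (1 : ℝ) else 0)
    with hg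
  have hg0 : ∀ S, 0 ≤ g S := fun S =>
    Finset.sum_nonneg fun v _ => Finset.sum_nonneg fun w _ => by split_ifs <;> norm_num
  have hgempty : g ∅ = 0 := by simp [hg]
  -- per index: `∑_S q (#(S ∩ e) − 1_{S ∩ e ≠ ∅}) ≤ 2θ⁻¹ ∑_{v} ∑_{w ≠ v} P(v,w ∈ 𝐞_i)`
  have hi_bound : ∀ i ∈ 𝔑.T,
      ∑ S, 𝔑.q W i S * #(S ∩ e) - 𝔑.π e W i ≤
        2 * 𝔑.θ⁻¹ * ∑ v ∈ e, ∑ w ∈ e.erase v, probPairMem (𝔑.μ i) v w := by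
    intro i hi
    rw [π_eq, ← Finset.sum_sub_distrib]
    have h1 : ∑ S, (𝔑.q W i S * #(S ∩ e) - 𝔑.q W i S * (if (S ∩ e).Nonempty then 1 else 0)) ≤
        ∑ S, 𝔑.q W i S * g S := by
      refine Finset.sum_le_sum fun S _ => ?_
      rw [← mul_sub]
      exact mul_le_mul_of_nonneg_left (card_sub_ite_le_sum_pairs S e) (𝔑.q_nonneg hi W S)
    refine h1.trans ((𝔑.sum_q_mul_le hi W hg0 hgempty).trans (le_of_eq ?_))
    congr 1
    simp only [hg, Finset.mul_sum]
    rw [Finset.sum_comm]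
    refine Finset.sum_congr rfl fun v _ => ?_
    rw [Finset.sum_comm]
    refine Finset.sum_congr rfl fun w _ => ?_
    rw [probPairMem_eq_sum_ite]
    exact Finset.sum_congr rfl fun S _ => by split_ifs <;> simp
  -- sum over `i` and use (4.8)
  have hsum : 𝔑.Se e W - ∑ i ∈ 𝔑.T, 𝔑.π e W i ≤
      2 * 𝔑.θ⁻¹ * ∑ v ∈ e, ∑ w ∈ e.erase v, ∑ i ∈ 𝔑.T, probPairMem (𝔑.μ i) v w := by
    rw [Se, ← Finset.sum_sub_distrib]
    refine (Finset.sum_le_sum hi_bound).trans (le_of_eq ?_)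
    rw [← Finset.mul_sum, Finset.sum_comm]
    congr 1
    exact Finset.sum_congr rfl fun v _ => Finset.sum_comm
  have hpairs : ∑ v ∈ e, ∑ w ∈ e.erase v, ∑ i ∈ 𝔑.T, probPairMem (𝔑.μ i) v w ≤ 𝔑.s ^ 2 * 𝔑.δ := by
    have he0 : (0 : ℝ) ≤ #e := Nat.cast_nonneg _
    calc ∑ v ∈ e, ∑ w ∈ e.erase v, ∑ i ∈ 𝔑.T, probPairMem (𝔑.μ i) v w
        ≤ ∑ v ∈ e, ∑ _w ∈ e.erase v, 𝔑.δ :=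
          Finset.sum_le_sum fun v _ => Finset.sum_le_sum fun w hw =>
            𝔑.hcodeg v w (Finset.ne_of_mem_erase hw).symm
      _ ≤ ∑ _v ∈ e, #e * 𝔑.δ := by
          refine Finset.sum_le_sum fun v _ => ?_
          rw [Finset.sum_const, nsmul_eq_mul]
          exact mul_le_mul_of_nonneg_right (by exact_mod_cast Finset.card_erase_le) 𝔑.hδ.le
      _ = #e * #e * 𝔑.δ := by rw [Finset.sum_const, nsmul_eq_mul]; ring
      _ ≤ 𝔑.s * 𝔑.s * 𝔑.δ := by
          refine mul_le_mul_of_nonneg_right (mul_le_mul he he he0 𝔑.hs) 𝔑.hδ.le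
      _ = 𝔑.s ^ 2 * 𝔑.δ := by ring
  have : 2 * 𝔑.θ⁻¹ * ∑ v ∈ e, ∑ w ∈ e.erase v, ∑ i ∈ 𝔑.T, probPairMem (𝔑.μ i) v w ≤ 𝔑.γ := by
    unfold γ
    nlinarith [mul_le_mul_of_nonneg_left hpairs hθi]
  linarith

/-- [cite: FordGreenKonyaginMaynardTao2018, §5 (factorisation of `Y(W)`)] -/
theorem Y_nonneg (W : Finset V) (he : (#e : ℝ) ≤ 𝔑.s) : 0 ≤ 𝔑.Y e W := by
  rw [Y_eq_prod]
  exact Finset.prod_nonneg fun i hi => by linarith [𝔑.π_le_α hi W he, 𝔑.α_le_half]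

/-- [cite: FordGreenKonyaginMaynardTao2018, §5 (factorisation of `Y(W)`)] -/
theorem Y_le_one (W : Finset V) (he : (#e : ℝ) ≤ 𝔑.s) : 𝔑.Y e W ≤ 1 := by
  rw [Y_eq_prod]
  exact Finset.prod_le_one (fun i hi => by linarith [𝔑.π_le_α hi W he, 𝔑.α_le_half])
    fun i hi => by linarith [𝔑.π_nonneg (e := e) hi W]

/-- **Upper Taylor bound:** `Y(W) ≤ exp(−S_e(W) + γ)`.
[cite: FordGreenKonyaginMaynardTao2018, §5 («`1 − P(…) = exp(−P(…) + O(P(…)²))`»)] -/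
theorem Y_le_exp (W : Finset V) (he : (#e : ℝ) ≤ 𝔑.s) :
    𝔑.Y e W ≤ Real.exp (-𝔑.Se e W + 𝔑.γ) := by
  rw [Y_eq_prod]
  refine ((prod_one_sub_bounds 𝔑.T (𝔑.π e W) (fun i hi => 𝔑.π_nonneg hi W)
    fun i hi => (𝔑.π_le_α hi W he).trans 𝔑.α_le_half).2).trans ?_
  rw [Real.exp_le_exp]
  linarith [𝔑.Se_le_sum_π_add W he]

/-- **Lower Taylor bound:** `exp(−(1 + 2α) S_e(W)) ≤ Y(W)`.
[cite: FordGreenKonyaginMaynardTao2018, §5 («`1 − P(…) = exp(−P(…) + O(P(…)²))`»)] -/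
theorem exp_le_Y (W : Finset V) (he : (#e : ℝ) ≤ 𝔑.s) :
    Real.exp (-((1 + 2 * 𝔑.α) * 𝔑.Se e W)) ≤ 𝔑.Y e W := by
  rw [Y_eq_prod]
  refine le_trans ?_ (prod_one_sub_bounds 𝔑.T (𝔑.π e W) (fun i hi => 𝔑.π_nonneg hi W)
    fun i hi => (𝔑.π_le_α hi W he).trans 𝔑.α_le_half).1
  rw [Real.exp_le_exp, neg_le_neg_iff]
  have h1 : ∑ i ∈ 𝔑.T, (𝔑.π e W i + 2 * 𝔑.π e W i ^ 2) ≤ (1 + 2 * 𝔑.α) * ∑ i ∈ 𝔑.T, 𝔑.π e W i := by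
    rw [Finset.mul_sum]
    refine Finset.sum_le_sum fun i hi => ?_
    have h0 := 𝔑.π_nonneg (e := e) hi W
    have hα := 𝔑.π_le_α hi W he
    nlinarith [mul_le_mul_of_nonneg_left hα h0]
  refine h1.trans (mul_le_mul_of_nonneg_left (𝔑.sum_π_le_Se W) ?_)
  linarith [𝔑.α_nonneg]

/-! ### The main term: `S_e(W)` versus `∑_{v ∈ e} M_v(W)` -/

/-- `R_{i,v}(W) := E(1_{𝐞_i ⊆ W, v ∈ 𝐞_i}/P_{m−1}(𝐞_i))`.
[cite: FordGreenKonyaginMaynardTao2018, §5 (display (5.3)′: `E(#(e ∩ 𝐞'_i) | 𝐖 = W) = (1_{F_i}/X_i) ∑_{v ∈ e} …`)] -/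
def R (v : V) (W : Finset V) (i : ι) : ℝ :=
  ∑ S, 𝔑.μ i S / 𝔑.P S * (if S ⊆ W then 1 else 0) * (if v ∈ S then 1 else 0)

/-- `M_v(W) := ∑_{i ∈ I_m} R_{i,v}(W)` (the inner sum of the main term).
[cite: FordGreenKonyaginMaynardTao2018, §5 (the main term after (5.3))] -/
def M (v : V) (W : Finset V) : ℝ := ∑ i ∈ 𝔑.T, 𝔑.R v W i

/-- The error `Err_v(W) = 2tκ^{-r} d(v) + κ^{-r} ∑_{i : F_i(W) fails} P(v ∈ 𝐞_i)` controlling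
`|S_e(W) − ∑_v M_v(W)|`. [cite: FordGreenKonyaginMaynardTao2018, §5 («The contribution of the error term `δ^{1/(3·10^m)}`… the failure event»)] -/
def Err (v : V) (W : Finset V) : ℝ :=
  2 * 𝔑.t * 𝔑.θ⁻¹ * normDegree 𝔑.μ 𝔑.T v +
    𝔑.θ⁻¹ * ∑ i ∈ 𝔑.T, (if |𝔑.X i W - 1| ≤ 𝔑.t then 0 else probMem (𝔑.μ i) v)

/-- [cite: FordGreenKonyaginMaynardTao2018, §5] -/
theorem R_nonneg {i : ι} (hi : i ∈ 𝔑.T) (v : V) (W : Finset V) : 0 ≤ 𝔑.R v W i :=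
  Finset.sum_nonneg fun S _ => by
    have := div_nonneg (𝔑.μ_nonneg hi S) (𝔑.P_pos S).le
    split_ifs <;> simp [this]

/-- `R_{i,v}(W) ≤ κ^{-r} P(v ∈ 𝐞_i)` ((5.1)). [cite: FordGreenKonyaginMaynardTao2018, §5 (5.1)] -/
theorem R_le {i : ι} (hi : i ∈ 𝔑.T) (v : V) (W : Finset V) :
    𝔑.R v W i ≤ 𝔑.θ⁻¹ * probMem (𝔑.μ i) v := by
  rw [R, probMem_eq_sum_ite, Finset.mul_sum]
  refine Finset.sum_le_sum fun S _ => ?_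
  by_cases hS : 𝔑.μ i S = 0
  · simp [hS]
  have hθP := 𝔑.θ_le_P hi hS (subset_refl S)
  have hμ := 𝔑.μ_nonneg hi S
  have hdiv : 𝔑.μ i S / 𝔑.P S ≤ 𝔑.θ⁻¹ * 𝔑.μ i S := by
    rw [div_le_iff₀ (𝔑.P_pos S)]
    calc 𝔑.μ i S = 𝔑.θ⁻¹ * 𝔑.μ i S * 𝔑.θ := by field_simp [𝔑.hθ0.ne']
      _ ≤ 𝔑.θ⁻¹ * 𝔑.μ i S * 𝔑.P S :=
          mul_le_mul_of_nonneg_left hθP (mul_nonneg (inv_nonneg.2 𝔑.hθ0.le) hμ)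
  have h0 : 0 ≤ 𝔑.μ i S / 𝔑.P S := div_nonneg hμ (𝔑.P_pos S).le
  split_ifs <;> simp <;> nlinarith [mul_nonneg (inv_nonneg.2 𝔑.hθ0.le) hμ]

/-- [cite: FordGreenKonyaginMaynardTao2018, §5] -/
theorem M_nonneg (v : V) (W : Finset V) : 0 ≤ 𝔑.M v W :=
  Finset.sum_nonneg fun _ hi => 𝔑.R_nonneg hi v W

/-- `M_v(W) ≤ κ^{-r} d(v)`. [cite: FordGreenKonyaginMaynardTao2018, §5 (5.1)] -/
theorem M_le (v : V) (W : Finset V) : 𝔑.M v W ≤ 𝔑.θ⁻¹ * normDegree 𝔑.μ 𝔑.T v := by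
  rw [M, normDegree, Finset.mul_sum]
  exact Finset.sum_le_sum fun i hi => 𝔑.R_le hi v W

/-- `S_e(W) = ∑_{v ∈ e} ∑_i ∑_S q_i(S | W) 1_{v ∈ S}`. [cite: FordGreenKonyaginMaynardTao2018, §5 (5.3)′] -/
theorem Se_eq_sum (W : Finset V) :
    𝔑.Se e W = ∑ v ∈ e, ∑ i ∈ 𝔑.T, ∑ S, 𝔑.q W i S * (if v ∈ S then 1 else 0) := by
  rw [Se]
  symm
  calc ∑ v ∈ e, ∑ i ∈ 𝔑.T, ∑ S, 𝔑.q W i S * (if v ∈ S then (1 : ℝ) else 0)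
      = ∑ i ∈ 𝔑.T, ∑ v ∈ e, ∑ S, 𝔑.q W i S * (if v ∈ S then (1 : ℝ) else 0) := Finset.sum_comm
    _ = ∑ i ∈ 𝔑.T, ∑ S, 𝔑.q W i S * #(S ∩ e) := by
        refine Finset.sum_congr rfl fun i _ => ?_
        rw [Finset.sum_comm]
        refine Finset.sum_congr rfl fun S _ => ?_
        rw [← Finset.mul_sum, sum_ite_mem_eq_card_inter]

/-- On `F_i(W)`: `∑_S q_i(S|W) 1_{v ∈ S} = R_{i,v}(W)/X_i(W)`. [cite: FordGreenKonyaginMaynardTao2018, §5 (5.3)′] -/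
theorem sum_q_ite_of_F {i : ι} {W : Finset V} (hF : |𝔑.X i W - 1| ≤ 𝔑.t) (v : V) :
    ∑ S, 𝔑.q W i S * (if v ∈ S then 1 else 0) = 1 / 𝔑.X i W * 𝔑.R v W i := by
  rw [R, Finset.mul_sum]
  refine Finset.sum_congr rfl fun S _ => ?_
  rw [𝔑.q_eq_of_F hF]
  split_ifs <;> ring

/-- If `F_i(W)` fails: `∑_S q_i(S|W) 1_{v ∈ S} = 0` (`𝐞'_i = ∅`). [cite: FordGreenKonyaginMaynardTao2018, §5 (definition of `𝐞'_i`)] -/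
theorem sum_q_ite_of_not_F {i : ι} {W : Finset V} (hF : ¬ |𝔑.X i W - 1| ≤ 𝔑.t) (v : V) :
    ∑ S, 𝔑.q W i S * (if v ∈ S then (1 : ℝ) else 0) = 0 := by
  simp_rw [𝔑.q_of_not_F hF]
  exact Finset.sum_eq_zero fun S _ => by
    by_cases h : S = ∅
    · simp [h]
    · simp [h]

/-- **`|S_e(W) − ∑_{v ∈ e} M_v(W)| ≤ ∑_{v ∈ e} Err_v(W)`** («`1_{F_i}/X_i = 1 + O(δ^{1/(3·10^m)})` on
`F_i`, and the terms with `F_i` failing are controlled by `κ^{-r}P(v ∈ 𝐞_i)`»).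
[cite: FordGreenKonyaginMaynardTao2018, §5 (main term, displays after (5.3))] -/
theorem abs_Se_sub_sum_M_le (W : Finset V) :
    |𝔑.Se e W - ∑ v ∈ e, 𝔑.M v W| ≤ ∑ v ∈ e, 𝔑.Err v W := by
  rw [Se_eq_sum, ← Finset.sum_sub_distrib]
  refine (Finset.abs_sum_le_sum_abs _ _).trans (Finset.sum_le_sum fun v _ => ?_)
  rw [M, ← Finset.sum_sub_distrib]
  refine (Finset.abs_sum_le_sum_abs _ _).trans ?_
  have hθi : 0 ≤ 𝔑.θ⁻¹ := inv_nonneg.2 𝔑.hθ0.le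
  have hterm : ∀ i ∈ 𝔑.T, |∑ S, 𝔑.q W i S * (if v ∈ S then (1 : ℝ) else 0) - 𝔑.R v W i| ≤
      2 * 𝔑.t * 𝔑.θ⁻¹ * probMem (𝔑.μ i) v +
        𝔑.θ⁻¹ * (if |𝔑.X i W - 1| ≤ 𝔑.t then 0 else probMem (𝔑.μ i) v) := by
    intro i hi
    have hR0 := 𝔑.R_nonneg hi v W
    have hR := 𝔑.R_le hi v W
    have hpm : 0 ≤ probMem (𝔑.μ i) v := probMem_nonneg (𝔑.μ_nonneg hi) v
    by_cases hF : |𝔑.X i W - 1| ≤ 𝔑.t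
    · rw [𝔑.sum_q_ite_of_F hF, if_pos hF, show 1 / 𝔑.X i W * 𝔑.R v W i - 𝔑.R v W i =
        (1 / 𝔑.X i W - 1) * 𝔑.R v W i by ring, abs_mul, abs_of_nonneg hR0]
      have h1 := abs_inv_sub_one_le 𝔑.t_le_half hF
      calc |1 / 𝔑.X i W - 1| * 𝔑.R v W i ≤ 2 * 𝔑.t * (𝔑.θ⁻¹ * probMem (𝔑.μ i) v) :=
            mul_le_mul h1 hR hR0 (by linarith [𝔑.t_pos])
        _ = 2 * 𝔑.t * 𝔑.θ⁻¹ * probMem (𝔑.μ i) v + 𝔑.θ⁻¹ * 0 := by ring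
    · rw [𝔑.sum_q_ite_of_not_F hF, if_neg hF, zero_sub, abs_neg, abs_of_nonneg hR0]
      nlinarith [𝔑.t_pos, mul_nonneg hθi hpm]
  refine (Finset.sum_le_sum hterm).trans (le_of_eq ?_)
  rw [Err, normDegree, Finset.sum_add_distrib, ← Finset.mul_sum, ← Finset.mul_sum]

/-- [cite: FordGreenKonyaginMaynardTao2018, §5] -/
theorem Err_nonneg (v : V) (W : Finset V) : 0 ≤ 𝔑.Err v W := by
  have hθi : 0 ≤ 𝔑.θ⁻¹ := inv_nonneg.2 𝔑.hθ0.le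
  have hd : 0 ≤ normDegree 𝔑.μ 𝔑.T v :=
    Finset.sum_nonneg fun i hi => probMem_nonneg (𝔑.μ_nonneg hi) v
  refine add_nonneg (by have := 𝔑.t_pos; positivity) (mul_nonneg hθi (Finset.sum_nonneg fun i hi => ?_))
  split_ifs
  · exact le_rfl
  · exact probMem_nonneg (𝔑.μ_nonneg hi) v

/-- [cite: FordGreenKonyaginMaynardTao2018, (4.12)] -/
theorem normDegree_le (v : V) : normDegree 𝔑.μ 𝔑.T v ≤ 𝔑.D :=
  (𝔑.hdeg v).trans (by nlinarith [𝔑.hp1 v, 𝔑.hD])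

/-- [cite: FordGreenKonyaginMaynardTao2018, (4.12)] -/
theorem normDegree_nonneg (v : V) : 0 ≤ normDegree 𝔑.μ 𝔑.T v :=
  Finset.sum_nonneg fun _ hi => probMem_nonneg (𝔑.μ_nonneg hi) v

/-- **`E Err_v(𝐖) ≤ κ^{-r}(2t + φ) D`** (Lemma 5.1 for the failure terms, (4.12) for `d(v) ≤ D`).
[cite: FordGreenKonyaginMaynardTao2018, §5 (error terms) with Lemma 5.1] -/
theorem E_Err_le (v : V) : 𝔑.E (fun ω => 𝔑.Err v (𝔑.W ω)) ≤ 𝔑.θ⁻¹ * (2 * 𝔑.t + 𝔑.φ) * 𝔑.D := by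
  have hθi : 0 ≤ 𝔑.θ⁻¹ := inv_nonneg.2 𝔑.hθ0.le
  have hsplit : 𝔑.E (fun ω => 𝔑.Err v (𝔑.W ω)) =
      2 * 𝔑.t * 𝔑.θ⁻¹ * normDegree 𝔑.μ 𝔑.T v +
        𝔑.θ⁻¹ * ∑ i ∈ 𝔑.T, 𝔑.E (fun ω =>
          if |𝔑.X i (𝔑.W ω) - 1| ≤ 𝔑.t then 0 else probMem (𝔑.μ i) v) := by
    have hc : ∀ c : ℝ, 𝔑.E (fun _ => c) = c := by
      intro c
      have := 𝔑.E_mul_left c (fun _ => 1)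
      rw [𝔑.E_one, mul_one] at this
      simpa using this
    simp only [Err]
    rw [𝔑.E_add, hc, 𝔑.E_mul_left, 𝔑.E_sum]
  have hfail : ∀ i ∈ 𝔑.T, 𝔑.E (fun ω =>
      if |𝔑.X i (𝔑.W ω) - 1| ≤ 𝔑.t then 0 else probMem (𝔑.μ i) v) ≤ probMem (𝔑.μ i) v * 𝔑.φ := by
    intro i hi
    have hpm : 0 ≤ probMem (𝔑.μ i) v := probMem_nonneg (𝔑.μ_nonneg hi) v
    have h1 : 𝔑.E (fun ω => if |𝔑.X i (𝔑.W ω) - 1| ≤ 𝔑.t then 0 else probMem (𝔑.μ i) v) =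
        probMem (𝔑.μ i) v * 𝔑.E (fun ω => if 𝔑.t < |𝔑.X i (𝔑.W ω) - 1| then 1 else 0) := by
      rw [← 𝔑.E_mul_left]
      congr 1
      ext ω
      by_cases h : |𝔑.X i (𝔑.W ω) - 1| ≤ 𝔑.t
      · simp [h, not_lt.2 h]
      · simp [h, not_le.1 h]
    rw [h1, ← 𝔑.mass_eq_E]
    exact mul_le_mul_of_nonneg_left (𝔑.mass_not_F_le hi) hpm
  rw [hsplit]
  have hsum : ∑ i ∈ 𝔑.T, 𝔑.E (fun ω =>
      if |𝔑.X i (𝔑.W ω) - 1| ≤ 𝔑.t then 0 else probMem (𝔑.μ i) v) ≤ normDegree 𝔑.μ 𝔑.T v * 𝔑.φ := by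
    rw [normDegree, Finset.sum_mul]
    exact Finset.sum_le_sum hfail
  have hd := 𝔑.normDegree_le v
  have hd0 := 𝔑.normDegree_nonneg v
  have hφ := 𝔑.φ_nonneg
  have ht := 𝔑.t_pos
  nlinarith [mul_le_mul_of_nonneg_left hsum hθi, mul_le_mul_of_nonneg_left hd hθi,
    mul_le_mul_of_nonneg_left hd (mul_nonneg hθi hφ), mul_le_mul_of_nonneg_left hd (mul_nonneg hθi ht.le)]

end FixedSet

/-! ### Moments of the main term `M_v` ((5.7)–(5.8), i.e. the displays (z-1), (z-2) of §5) -/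

section Moments

/-- The coefficient `1_{v ∈ S} P(𝐞_i = S)/P_{m−1}(S)` of `1_{S ⊆ W}` in `R_{i,v}(W)`.
[cite: FordGreenKonyaginMaynardTao2018, §5 (5.7)] -/
def cR (v : V) (i : ι) (S : Finset V) : ℝ := 𝔑.μ i S / 𝔑.P S * (if v ∈ S then 1 else 0)

/-- [cite: FordGreenKonyaginMaynardTao2018, §5 (5.7)] -/
theorem cR_nonneg {i : ι} (hi : i ∈ 𝔑.T) (v : V) (S : Finset V) : 0 ≤ 𝔑.cR v i S := by
  unfold cR
  have := div_nonneg (𝔑.μ_nonneg hi S) (𝔑.P_pos S).le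
  split_ifs <;> simp [this]

/-- [cite: FordGreenKonyaginMaynardTao2018, §5 (5.7)] -/
theorem cR_of_not_mem {i : ι} {v : V} {S : Finset V} (h : v ∉ S) : 𝔑.cR v i S = 0 := by
  simp [cR, h]

/-- [cite: FordGreenKonyaginMaynardTao2018, §5 (5.7)] -/
theorem cR_of_zero {i : ι} {S : Finset V} (v : V) (h : 𝔑.μ i S = 0) : 𝔑.cR v i S = 0 := by
  simp [cR, h]

/-- [cite: FordGreenKonyaginMaynardTao2018, §5 (5.7)] -/
theorem R_eq_sum_cR (v : V) (i : ι) (ω : Ω) :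
    𝔑.R v (𝔑.W ω) i = ∑ S, 𝔑.cR v i S * 𝔑.ind S ω :=
  Finset.sum_congr rfl fun S _ => by unfold cR ind; ring

/-- [cite: FordGreenKonyaginMaynardTao2018, §5 (5.7)] -/
theorem M_eq_sum_cR (v : V) (ω : Ω) :
    𝔑.M v (𝔑.W ω) = ∑ i ∈ 𝔑.T, ∑ S, 𝔑.cR v i S * 𝔑.ind S ω := by
  rw [M]
  exact Finset.sum_congr rfl fun i _ => 𝔑.R_eq_sum_cR v i ω

/-- The key identity «`P(e' ∪ ẽ)/P(ẽ) = P(e')/(p(v) P((ẽ ∩ e') ∖ {v}))`» for `v ∈ ẽ ∩ e'` ((4.14)).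
[cite: FordGreenKonyaginMaynardTao2018, §5 proof of (5.7)] -/
theorem cR_mul_P_union {i : ι} {S e' : Finset V} {v : V} (hvS : v ∈ S) (hve : v ∈ e') :
    𝔑.cR v i S * 𝔑.P (e' ∪ S) = 𝔑.P e' / 𝔑.p v * (𝔑.μ i S * (1 / 𝔑.P ((S ∩ e').erase v))) := by
  have h1 : 𝔑.P (S ∪ e') * 𝔑.P (S ∩ e') = 𝔑.P S * 𝔑.P e' := 𝔑.P_union_inter S e'
  have h2 : 𝔑.p v * 𝔑.P ((S ∩ e').erase v) = 𝔑.P (S ∩ e') :=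
    mul_pw_erase 𝔑.p (Finset.mem_inter.2 ⟨hvS, hve⟩)
  have hPS := (𝔑.P_pos S).ne'
  have hpv := (𝔑.p_pos v).ne'
  have hPX := (𝔑.P_pos ((S ∩ e').erase v)).ne'
  have h3 : 𝔑.P (e' ∪ S) = 𝔑.P S * 𝔑.P e' / (𝔑.p v * 𝔑.P ((S ∩ e').erase v)) := by
    rw [h2, eq_div_iff (𝔑.P_pos _).ne', Finset.union_comm]; exact h1
  rw [h3, cR, if_pos hvS]
  field_simp

/-- `∑_i ∑_S c_{i,S} P(e' ∪ S) ≤ (P(e')/p(v)) (d(v) + κ^{-r} #e' δ)` («by (4.8)», the `O(δ)` cross terms).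
[cite: FordGreenKonyaginMaynardTao2018, §5 proof of (5.7)] -/
theorem sum_cR_P_union_le {v : V} {e' : Finset V} (hve : v ∈ e') :
    ∑ i ∈ 𝔑.T, ∑ S, 𝔑.cR v i S * 𝔑.P (e' ∪ S) ≤
      𝔑.P e' / 𝔑.p v * (normDegree 𝔑.μ 𝔑.T v + 𝔑.θ⁻¹ * #e' * 𝔑.δ) := by
  have hθi : 0 ≤ 𝔑.θ⁻¹ := inv_nonneg.2 𝔑.hθ0.le
  have hK : 0 ≤ 𝔑.P e' / 𝔑.p v := div_nonneg (𝔑.P_pos e').le (𝔑.p_pos v).le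
  -- termwise
  have hterm : ∀ i ∈ 𝔑.T, ∀ S : Finset V, 𝔑.cR v i S * 𝔑.P (e' ∪ S) ≤
      𝔑.P e' / 𝔑.p v * (𝔑.μ i S * (if v ∈ S then 1 else 0) +
        𝔑.θ⁻¹ * (𝔑.μ i S * (if v ∈ S then (#((S ∩ e').erase v) : ℝ) else 0))) := by
    intro i hi S
    by_cases hvS : v ∈ S
    · by_cases hS : 𝔑.μ i S = 0
      · simp [𝔑.cR_of_zero v hS, hS]
      rw [𝔑.cR_mul_P_union hvS hve, if_pos hvS, if_pos hvS, mul_one]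
      refine mul_le_mul_of_nonneg_left ?_ hK
      have hinv := inv_pw_le_one_add 𝔑.hθ0
        (𝔑.θ_le_P hi hS ((Finset.erase_subset _ _).trans Finset.inter_subset_left) :
          𝔑.θ ≤ 𝔑.P ((S ∩ e').erase v))
      have hμ := 𝔑.μ_nonneg hi S
      calc 𝔑.μ i S * (1 / 𝔑.P ((S ∩ e').erase v)) ≤ 𝔑.μ i S * (1 + 𝔑.θ⁻¹ * #((S ∩ e').erase v)) :=
            mul_le_mul_of_nonneg_left hinv hμ
        _ = 𝔑.μ i S + 𝔑.θ⁻¹ * (𝔑.μ i S * #((S ∩ e').erase v)) := by ring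
    · rw [𝔑.cR_of_not_mem hvS]
      simp [hvS]
  -- sum
  calc ∑ i ∈ 𝔑.T, ∑ S, 𝔑.cR v i S * 𝔑.P (e' ∪ S)
      ≤ ∑ i ∈ 𝔑.T, ∑ S, 𝔑.P e' / 𝔑.p v * (𝔑.μ i S * (if v ∈ S then 1 else 0) +
          𝔑.θ⁻¹ * (𝔑.μ i S * (if v ∈ S then (#((S ∩ e').erase v) : ℝ) else 0))) :=
        Finset.sum_le_sum fun i hi => Finset.sum_le_sum fun S _ => hterm i hi S
    _ = 𝔑.P e' / 𝔑.p v * (normDegree 𝔑.μ 𝔑.T v +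
          𝔑.θ⁻¹ * ∑ w ∈ e'.erase v, ∑ i ∈ 𝔑.T, probPairMem (𝔑.μ i) v w) := by
        rw [normDegree, Finset.sum_comm (s := e'.erase v), Finset.mul_sum, ← Finset.sum_add_distrib,
          Finset.mul_sum]
        refine Finset.sum_congr rfl fun i _ => ?_
        rw [← Finset.mul_sum, Finset.sum_add_distrib, ← Finset.mul_sum, sum_mul_ite_card_erase,
          probMem_eq_sum_ite]
        congr 2
        exact Finset.sum_congr rfl fun S _ => by split_ifs <;> simp
    _ ≤ 𝔑.P e' / 𝔑.p v * (normDegree 𝔑.μ 𝔑.T v + 𝔑.θ⁻¹ * #e' * 𝔑.δ) := by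
        refine mul_le_mul_of_nonneg_left ?_ hK
        have h : ∑ w ∈ e'.erase v, ∑ i ∈ 𝔑.T, probPairMem (𝔑.μ i) v w ≤ #e' * 𝔑.δ :=
          calc ∑ w ∈ e'.erase v, ∑ i ∈ 𝔑.T, probPairMem (𝔑.μ i) v w ≤ ∑ _w ∈ e'.erase v, 𝔑.δ :=
                Finset.sum_le_sum fun w hw => 𝔑.hcodeg v w (Finset.ne_of_mem_erase hw).symm
            _ = #(e'.erase v) * 𝔑.δ := by rw [Finset.sum_const, nsmul_eq_mul]
            _ ≤ #e' * 𝔑.δ :=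
                mul_le_mul_of_nonneg_right (by exact_mod_cast Finset.card_erase_le) 𝔑.hδ.le
        nlinarith [mul_le_mul_of_nonneg_left h hθi]

/-- `∑_i ∑_S c_{i,S} P(e' ∪ S) ≥ (P(e')/p(v)) d(v)`. [cite: FordGreenKonyaginMaynardTao2018, §5 proof of (5.7)] -/
theorem le_sum_cR_P_union {v : V} {e' : Finset V} (hve : v ∈ e') :
    𝔑.P e' / 𝔑.p v * normDegree 𝔑.μ 𝔑.T v ≤ ∑ i ∈ 𝔑.T, ∑ S, 𝔑.cR v i S * 𝔑.P (e' ∪ S) := by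
  have hK : 0 ≤ 𝔑.P e' / 𝔑.p v := div_nonneg (𝔑.P_pos e').le (𝔑.p_pos v).le
  rw [normDegree, Finset.mul_sum]
  refine Finset.sum_le_sum fun i hi => ?_
  rw [probMem_eq_sum_ite, Finset.mul_sum]
  refine Finset.sum_le_sum fun S _ => ?_
  by_cases hvS : v ∈ S
  · rw [if_pos hvS, 𝔑.cR_mul_P_union hvS hve]
    refine mul_le_mul_of_nonneg_left ?_ hK
    have hμ := 𝔑.μ_nonneg hi S
    have h1 : 1 ≤ 1 / 𝔑.P ((S ∩ e').erase v) := by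
      rw [le_div_iff₀ (𝔑.P_pos _), one_mul]; exact 𝔑.P_le_one _
    nlinarith
  · rw [if_neg hvS, 𝔑.cR_of_not_mem hvS]; simp

/-- `1_{e' ⊆ W} M_v(W) = ∑_i ∑_S c_{i,S} 1_{e' ∪ S ⊆ W}`. [cite: FordGreenKonyaginMaynardTao2018, §5 (5.7)] -/
theorem ind_mul_M (e' : Finset V) (v : V) (ω : Ω) :
    𝔑.ind e' ω * 𝔑.M v (𝔑.W ω) = ∑ i ∈ 𝔑.T, ∑ S, 𝔑.cR v i S * 𝔑.ind (e' ∪ S) ω := by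
  rw [𝔑.M_eq_sum_cR, Finset.mul_sum]
  refine Finset.sum_congr rfl fun i _ => ?_
  rw [Finset.mul_sum]
  refine Finset.sum_congr rfl fun S _ => ?_
  rw [← 𝔑.ind_mul_ind]; ring

/-- `E 1_{e' ⊆ 𝐖} M_v(𝐖) = ∑_i ∑_S c_{i,S} P(e' ∪ S ⊆ 𝐖)`. [cite: FordGreenKonyaginMaynardTao2018, §5 (5.7)] -/
theorem E_ind_M_eq (e' : Finset V) (v : V) :
    𝔑.E (fun ω => 𝔑.ind e' ω * 𝔑.M v (𝔑.W ω)) =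
      ∑ i ∈ 𝔑.T, ∑ S, 𝔑.cR v i S * 𝔑.E (𝔑.ind (e' ∪ S)) := by
  simp_rw [𝔑.ind_mul_M]
  rw [𝔑.E_sum]
  refine Finset.sum_congr rfl fun i _ => ?_
  rw [𝔑.E_sum]
  exact Finset.sum_congr rfl fun S _ => by rw [𝔑.E_mul_left]

/-- **(5.7), upper:** `E 1_{e' ⊆ 𝐖} M_v(𝐖) ≤ (1 + η)(P(e')/p(v))(d(v) + κ^{-r} #e' δ)` for `v ∈ e'`,
`#e' ≤ s + r`. [cite: FordGreenKonyaginMaynardTao2018, §5 (5.7)] -/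
theorem E_ind_M_le {v : V} {e' : Finset V} (hve : v ∈ e') (he' : (#e' : ℝ) ≤ 𝔑.s + 𝔑.r) :
    𝔑.E (fun ω => 𝔑.ind e' ω * 𝔑.M v (𝔑.W ω)) ≤
      (1 + 𝔑.η) * (𝔑.P e' / 𝔑.p v) * (normDegree 𝔑.μ 𝔑.T v + 𝔑.θ⁻¹ * #e' * 𝔑.δ) := by
  rw [E_ind_M_eq]
  have hη1 : 0 ≤ 1 + 𝔑.η := by linarith [𝔑.hη0]
  have hterm : ∀ i ∈ 𝔑.T, ∀ S : Finset V,
      𝔑.cR v i S * 𝔑.E (𝔑.ind (e' ∪ S)) ≤ (1 + 𝔑.η) * (𝔑.cR v i S * 𝔑.P (e' ∪ S)) := by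
    intro i hi S
    by_cases hS : 𝔑.μ i S = 0
    · simp [𝔑.cR_of_zero v hS]
    have hcard : (#(e' ∪ S) : ℝ) ≤ 𝔑.s + 2 * 𝔑.r := by
      have h1 := 𝔑.hsize i hi S hS
      have h2 : (#(e' ∪ S) : ℝ) ≤ #e' + #S := by exact_mod_cast Finset.card_union_le e' S
      linarith
    calc 𝔑.cR v i S * 𝔑.E (𝔑.ind (e' ∪ S)) ≤ 𝔑.cR v i S * ((1 + 𝔑.η) * 𝔑.P (e' ∪ S)) :=
          mul_le_mul_of_nonneg_left (𝔑.E_ind_le hcard) (𝔑.cR_nonneg hi v S)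
      _ = (1 + 𝔑.η) * (𝔑.cR v i S * 𝔑.P (e' ∪ S)) := by ring
  calc ∑ i ∈ 𝔑.T, ∑ S, 𝔑.cR v i S * 𝔑.E (𝔑.ind (e' ∪ S))
      ≤ ∑ i ∈ 𝔑.T, ∑ S, (1 + 𝔑.η) * (𝔑.cR v i S * 𝔑.P (e' ∪ S)) :=
        Finset.sum_le_sum fun i hi => Finset.sum_le_sum fun S _ => hterm i hi S
    _ = (1 + 𝔑.η) * ∑ i ∈ 𝔑.T, ∑ S, 𝔑.cR v i S * 𝔑.P (e' ∪ S) := by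
        rw [Finset.mul_sum]
        exact Finset.sum_congr rfl fun i _ => by rw [Finset.mul_sum]
    _ ≤ (1 + 𝔑.η) * (𝔑.P e' / 𝔑.p v * (normDegree 𝔑.μ 𝔑.T v + 𝔑.θ⁻¹ * #e' * 𝔑.δ)) :=
        mul_le_mul_of_nonneg_left (𝔑.sum_cR_P_union_le hve) hη1
    _ = _ := by ring

/-- **(5.7), lower:** `(1 − η)(P(e')/p(v)) d(v) ≤ E 1_{e' ⊆ 𝐖} M_v(𝐖)`.
[cite: FordGreenKonyaginMaynardTao2018, §5 (5.7)] -/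
theorem le_E_ind_M {v : V} {e' : Finset V} (hve : v ∈ e') (he' : (#e' : ℝ) ≤ 𝔑.s + 𝔑.r) :
    (1 - 𝔑.η) * (𝔑.P e' / 𝔑.p v) * normDegree 𝔑.μ 𝔑.T v ≤
      𝔑.E (fun ω => 𝔑.ind e' ω * 𝔑.M v (𝔑.W ω)) := by
  rw [E_ind_M_eq]
  have hη1 : 0 ≤ 1 - 𝔑.η := by linarith [𝔑.η_le_one]
  have hterm : ∀ i ∈ 𝔑.T, ∀ S : Finset V,
      (1 - 𝔑.η) * (𝔑.cR v i S * 𝔑.P (e' ∪ S)) ≤ 𝔑.cR v i S * 𝔑.E (𝔑.ind (e' ∪ S)) := by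
    intro i hi S
    by_cases hS : 𝔑.μ i S = 0
    · simp [𝔑.cR_of_zero v hS]
    have hcard : (#(e' ∪ S) : ℝ) ≤ 𝔑.s + 2 * 𝔑.r := by
      have h1 := 𝔑.hsize i hi S hS
      have h2 : (#(e' ∪ S) : ℝ) ≤ #e' + #S := by exact_mod_cast Finset.card_union_le e' S
      linarith
    calc (1 - 𝔑.η) * (𝔑.cR v i S * 𝔑.P (e' ∪ S)) = 𝔑.cR v i S * ((1 - 𝔑.η) * 𝔑.P (e' ∪ S)) := by
          ring
      _ ≤ 𝔑.cR v i S * 𝔑.E (𝔑.ind (e' ∪ S)) :=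
          mul_le_mul_of_nonneg_left (𝔑.le_E_ind hcard) (𝔑.cR_nonneg hi v S)
  calc (1 - 𝔑.η) * (𝔑.P e' / 𝔑.p v) * normDegree 𝔑.μ 𝔑.T v
      = (1 - 𝔑.η) * (𝔑.P e' / 𝔑.p v * normDegree 𝔑.μ 𝔑.T v) := by ring
    _ ≤ (1 - 𝔑.η) * ∑ i ∈ 𝔑.T, ∑ S, 𝔑.cR v i S * 𝔑.P (e' ∪ S) :=
        mul_le_mul_of_nonneg_left (𝔑.le_sum_cR_P_union hve) hη1
    _ = ∑ i ∈ 𝔑.T, ∑ S, (1 - 𝔑.η) * (𝔑.cR v i S * 𝔑.P (e' ∪ S)) := by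
        rw [Finset.mul_sum]
        exact Finset.sum_congr rfl fun i _ => by rw [Finset.mul_sum]
    _ ≤ _ := Finset.sum_le_sum fun i hi => Finset.sum_le_sum fun S _ => hterm i hi S

/-- `E 1_{e ⊆ 𝐖} M_v(𝐖)² = ∑_i ∑_S c_{i,S} E 1_{e ∪ S ⊆ 𝐖} M_v(𝐖)`.
[cite: FordGreenKonyaginMaynardTao2018, §5 (5.8)] -/
theorem E_ind_Msq_eq (e : Finset V) (v : V) :
    𝔑.E (fun ω => 𝔑.ind e ω * 𝔑.M v (𝔑.W ω) ^ 2) =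
      ∑ i ∈ 𝔑.T, ∑ S, 𝔑.cR v i S * 𝔑.E (fun ω => 𝔑.ind (e ∪ S) ω * 𝔑.M v (𝔑.W ω)) := by
  have h : ∀ ω, 𝔑.ind e ω * 𝔑.M v (𝔑.W ω) ^ 2 =
      ∑ i ∈ 𝔑.T, ∑ S, 𝔑.cR v i S * (𝔑.ind (e ∪ S) ω * 𝔑.M v (𝔑.W ω)) := by
    intro ω
    rw [sq, ← mul_assoc, 𝔑.ind_mul_M, Finset.sum_mul]
    refine Finset.sum_congr rfl fun i _ => ?_
    rw [Finset.sum_mul]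
    exact Finset.sum_congr rfl fun S _ => by ring
  simp_rw [h]
  rw [𝔑.E_sum]
  refine Finset.sum_congr rfl fun i _ => ?_
  rw [𝔑.E_sum]
  exact Finset.sum_congr rfl fun S _ => by rw [𝔑.E_mul_left]

/-- **(5.8):** `E 1_{e ⊆ 𝐖} M_v(𝐖)² ≤ (1 + η)(P(e)/p(v)²)(d(v) + κ^{-r}sδ)(d(v) + κ^{-r}(s + r)δ)` for
`v ∈ e`, `#e ≤ s` («the main terms multiply; the cross terms (a-1)–(a-3) are `O(δ)` by (4.8)»).
[cite: FordGreenKonyaginMaynardTao2018, §5 (5.8) with (a-1)–(a-3)] -/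
theorem E_ind_Msq_le {v : V} {e : Finset V} (hve : v ∈ e) (he : (#e : ℝ) ≤ 𝔑.s) :
    𝔑.E (fun ω => 𝔑.ind e ω * 𝔑.M v (𝔑.W ω) ^ 2) ≤
      (1 + 𝔑.η) * (𝔑.P e / 𝔑.p v ^ 2) *
        ((normDegree 𝔑.μ 𝔑.T v + 𝔑.θ⁻¹ * 𝔑.s * 𝔑.δ) *
          (normDegree 𝔑.μ 𝔑.T v + 𝔑.θ⁻¹ * (𝔑.s + 𝔑.r) * 𝔑.δ)) := by
  rw [E_ind_Msq_eq]
  have hθi : 0 ≤ 𝔑.θ⁻¹ := inv_nonneg.2 𝔑.hθ0.le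
  have hd0 := 𝔑.normDegree_nonneg v
  have hη1 : 0 ≤ 1 + 𝔑.η := by linarith [𝔑.hη0]
  have hpv := 𝔑.p_pos v
  set B := normDegree 𝔑.μ 𝔑.T v + 𝔑.θ⁻¹ * (𝔑.s + 𝔑.r) * 𝔑.δ with hB
  have hB0 : 0 ≤ B := add_nonneg hd0 (mul_nonneg (mul_nonneg hθi (by linarith [𝔑.hs, 𝔑.hr])) 𝔑.hδ.le)
  have hterm : ∀ i ∈ 𝔑.T, ∀ S : Finset V,
      𝔑.cR v i S * 𝔑.E (fun ω => 𝔑.ind (e ∪ S) ω * 𝔑.M v (𝔑.W ω)) ≤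
        (1 + 𝔑.η) * B / 𝔑.p v * (𝔑.cR v i S * 𝔑.P (e ∪ S)) := by
    intro i hi S
    by_cases hS : 𝔑.μ i S = 0
    · simp [𝔑.cR_of_zero v hS]
    have hcard : (#(e ∪ S) : ℝ) ≤ 𝔑.s + 𝔑.r := by
      have h1 := 𝔑.hsize i hi S hS
      have h2 : (#(e ∪ S) : ℝ) ≤ #e + #S := by exact_mod_cast Finset.card_union_le e S
      linarith
    have h := 𝔑.E_ind_M_le (Finset.mem_union_left S hve) hcard
    have h' : (1 + 𝔑.η) * (𝔑.P (e ∪ S) / 𝔑.p v) *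
        (normDegree 𝔑.μ 𝔑.T v + 𝔑.θ⁻¹ * #(e ∪ S) * 𝔑.δ) ≤
        (1 + 𝔑.η) * (𝔑.P (e ∪ S) / 𝔑.p v) * B := by
      refine mul_le_mul_of_nonneg_left ?_ (mul_nonneg hη1 (div_nonneg (𝔑.P_pos _).le hpv.le))
      rw [hB]
      nlinarith [mul_le_mul_of_nonneg_left hcard hθi, 𝔑.hδ.le,
        mul_le_mul_of_nonneg_right (mul_le_mul_of_nonneg_left hcard hθi) 𝔑.hδ.le]
    calc 𝔑.cR v i S * 𝔑.E (fun ω => 𝔑.ind (e ∪ S) ω * 𝔑.M v (𝔑.W ω))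
        ≤ 𝔑.cR v i S * ((1 + 𝔑.η) * (𝔑.P (e ∪ S) / 𝔑.p v) * B) :=
          mul_le_mul_of_nonneg_left (h.trans h') (𝔑.cR_nonneg hi v S)
      _ = (1 + 𝔑.η) * B / 𝔑.p v * (𝔑.cR v i S * 𝔑.P (e ∪ S)) := by
          field_simp
  have hK : 0 ≤ (1 + 𝔑.η) * B / 𝔑.p v := div_nonneg (mul_nonneg hη1 hB0) hpv.le
  calc ∑ i ∈ 𝔑.T, ∑ S, 𝔑.cR v i S * 𝔑.E (fun ω => 𝔑.ind (e ∪ S) ω * 𝔑.M v (𝔑.W ω))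
      ≤ ∑ i ∈ 𝔑.T, ∑ S, (1 + 𝔑.η) * B / 𝔑.p v * (𝔑.cR v i S * 𝔑.P (e ∪ S)) :=
        Finset.sum_le_sum fun i hi => Finset.sum_le_sum fun S _ => hterm i hi S
    _ = (1 + 𝔑.η) * B / 𝔑.p v * ∑ i ∈ 𝔑.T, ∑ S, 𝔑.cR v i S * 𝔑.P (e ∪ S) := by
        rw [Finset.mul_sum]
        exact Finset.sum_congr rfl fun i _ => by rw [Finset.mul_sum]
    _ ≤ (1 + 𝔑.η) * B / 𝔑.p v *
          (𝔑.P e / 𝔑.p v * (normDegree 𝔑.μ 𝔑.T v + 𝔑.θ⁻¹ * #e * 𝔑.δ)) :=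
        mul_le_mul_of_nonneg_left (𝔑.sum_cR_P_union_le hve) hK
    _ ≤ (1 + 𝔑.η) * B / 𝔑.p v *
          (𝔑.P e / 𝔑.p v * (normDegree 𝔑.μ 𝔑.T v + 𝔑.θ⁻¹ * 𝔑.s * 𝔑.δ)) := by
        refine mul_le_mul_of_nonneg_left (mul_le_mul_of_nonneg_left ?_
          (div_nonneg (𝔑.P_pos e).le hpv.le)) hK
        nlinarith [mul_le_mul_of_nonneg_right (mul_le_mul_of_nonneg_left he hθi) 𝔑.hδ.le]
    _ = _ := by
        rw [hB]
        field_simp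

/-- The variance bound constant `ζ = 4ηD² + 2κ^{-3r}δD(2s + r) + 2κ^{-4r}δ²s(s + r)`.
[cite: FordGreenKonyaginMaynardTao2018, §5 («`E 1_{e ⊆ 𝐖}(M_v − d(v)/P_{m−1}(v))² ≪ …`», display after (5.8))] -/
def ζ : ℝ := 4 * 𝔑.η * 𝔑.D ^ 2 + 2 * 𝔑.θ⁻¹ ^ 3 * 𝔑.δ * 𝔑.D * (2 * 𝔑.s + 𝔑.r) +
  2 * 𝔑.θ⁻¹ ^ 4 * 𝔑.δ ^ 2 * 𝔑.s * (𝔑.s + 𝔑.r)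

/-- [cite: FordGreenKonyaginMaynardTao2018, §5 (display after (5.8))] -/
theorem ζ_nonneg : 0 ≤ 𝔑.ζ := by
  have hθi : 0 ≤ 𝔑.θ⁻¹ := inv_nonneg.2 𝔑.hθ0.le
  have := 𝔑.hs; have := 𝔑.hr; have := 𝔑.hD; have := 𝔑.hδ; have := 𝔑.hη0
  unfold ζ; positivity

/-- Real-arithmetic tail of the variance bound: `(P/p²)(4ηd² + (1+η)B') ≤ P ζ`.
[cite: FordGreenKonyaginMaynardTao2018, §5 (display after (5.8))] -/
theorem variance_tail {P p d D θi η δ s r : ℝ} (hP : 0 < P) (hp : 0 < p) (hd0 : 0 ≤ d)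
    (hdD : d ≤ D * p) (hdle : d ≤ D) (hinvp : 1 / p ≤ θi) (hθi : 0 ≤ θi) (hη0 : 0 < η) (hη1 : η ≤ 1)
    (hδ : 0 < δ) (hs : 0 ≤ s) (hr : 1 ≤ r) :
    P / p ^ 2 * (4 * η * d ^ 2 + (1 + η) * (θi * δ * d * (2 * s + r) + θi ^ 2 * δ ^ 2 * s * (s + r))) ≤
      P * (4 * η * D ^ 2 + 2 * θi ^ 3 * δ * D * (2 * s + r) + 2 * θi ^ 4 * δ ^ 2 * s * (s + r)) := by
  set B' := θi * δ * d * (2 * s + r) + θi ^ 2 * δ ^ 2 * s * (s + r) with hB'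
  have hdp : d / p ≤ D := by rw [div_le_iff₀ hp]; exact hdD
  have hdp0 : 0 ≤ d / p := div_nonneg hd0 hp.le
  have hinvp0 : 0 ≤ 1 / p := div_nonneg zero_le_one hp.le
  have hB'0 : 0 ≤ B' := by rw [hB']; positivity
  have hB'le : B' ≤ θi * δ * D * (2 * s + r) + θi ^ 2 * δ ^ 2 * s * (s + r) := by
    rw [hB']
    have h0 : 0 ≤ θi * δ * (2 * s + r) := by positivity
    nlinarith [mul_le_mul_of_nonneg_left hdle h0]
  have hsq : P / p ^ 2 * (4 * η * d ^ 2 + (1 + η) * B') =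
      P * (4 * η * (d / p) ^ 2 + (1 + η) * B' * (1 / p) ^ 2) := by
    field_simp
  rw [hsq]
  refine mul_le_mul_of_nonneg_left ?_ hP.le
  have h1 : (d / p) ^ 2 ≤ D ^ 2 := pow_le_pow_left₀ hdp0 hdp 2
  have h2 : (1 / p) ^ 2 ≤ θi ^ 2 := pow_le_pow_left₀ hinvp0 hinvp 2
  have h3 : (1 + η) * B' ≤ 2 * B' := by nlinarith
  have ha := mul_le_mul_of_nonneg_left h1 (by positivity : (0 : ℝ) ≤ 4 * η)
  have hb : (1 + η) * B' * (1 / p) ^ 2 ≤ 2 * B' * θi ^ 2 :=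
    mul_le_mul h3 h2 (sq_nonneg _) (by positivity)
  have hc := mul_le_mul_of_nonneg_right hB'le (by positivity : (0 : ℝ) ≤ 2 * θi ^ 2)
  calc 4 * η * (d / p) ^ 2 + (1 + η) * B' * (1 / p) ^ 2 ≤ 4 * η * D ^ 2 + 2 * B' * θi ^ 2 := by
        linarith
    _ = 4 * η * D ^ 2 + B' * (2 * θi ^ 2) := by ring
    _ ≤ 4 * η * D ^ 2 + (θi * δ * D * (2 * s + r) + θi ^ 2 * δ ^ 2 * s * (s + r)) * (2 * θi ^ 2) := by
        linarith
    _ = _ := by ring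

/-- **Variance of the main term:** `E 1_{e ⊆ 𝐖}(M_v(𝐖) − d(v)/p(v))² ≤ P(e) ζ` for `v ∈ e`, `#e ≤ s`
(combining (5.2), (5.7), (5.8)). [cite: FordGreenKonyaginMaynardTao2018, §5 (display after (5.8))] -/
theorem E_ind_sq_dev_le {v : V} {e : Finset V} (hve : v ∈ e) (he : (#e : ℝ) ≤ 𝔑.s) :
    𝔑.E (fun ω => 𝔑.ind e ω * (𝔑.M v (𝔑.W ω) - normDegree 𝔑.μ 𝔑.T v / 𝔑.p v) ^ 2) ≤
      𝔑.P e * 𝔑.ζ := by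
  have hθi : 0 ≤ 𝔑.θ⁻¹ := inv_nonneg.2 𝔑.hθ0.le
  have hpv := 𝔑.p_pos v
  have hPe := 𝔑.P_pos e
  have hd0 := 𝔑.normDegree_nonneg v
  have her : (#e : ℝ) ≤ 𝔑.s + 𝔑.r := by linarith [𝔑.hr]
  have he2 : (#e : ℝ) ≤ 𝔑.s + 2 * 𝔑.r := by linarith [𝔑.hr]
  set d := normDegree 𝔑.μ 𝔑.T v with hd
  set L := d / 𝔑.p v with hL
  have hU := 𝔑.E_ind_Msq_le hve he
  have hMid := 𝔑.le_E_ind_M hve her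
  have hI := 𝔑.E_ind_le he2
  rw [← hd] at hU hMid
  have hexp : 𝔑.E (fun ω => 𝔑.ind e ω * (𝔑.M v (𝔑.W ω) - L) ^ 2) =
      𝔑.E (fun ω => 𝔑.ind e ω * 𝔑.M v (𝔑.W ω) ^ 2) -
        2 * L * 𝔑.E (fun ω => 𝔑.ind e ω * 𝔑.M v (𝔑.W ω)) + L ^ 2 * 𝔑.E (𝔑.ind e) := by
    rw [← 𝔑.E_mul_left, ← 𝔑.E_mul_left (L ^ 2), ← 𝔑.E_sub, ← 𝔑.E_add]
    simp only [E]
    exact Finset.sum_congr rfl fun ω _ => by ring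
  rw [hexp]
  have hL0 : 0 ≤ L := div_nonneg hd0 hpv.le
  set B' := 𝔑.θ⁻¹ * 𝔑.δ * d * (2 * 𝔑.s + 𝔑.r) + 𝔑.θ⁻¹ ^ 2 * 𝔑.δ ^ 2 * 𝔑.s * (𝔑.s + 𝔑.r)
    with hB'
  have hprod : (d + 𝔑.θ⁻¹ * 𝔑.s * 𝔑.δ) * (d + 𝔑.θ⁻¹ * (𝔑.s + 𝔑.r) * 𝔑.δ) = d ^ 2 + B' := by
    rw [hB']; ring
  rw [hprod] at hU
  have h1 : 2 * L * ((1 - 𝔑.η) * (𝔑.P e / 𝔑.p v) * d) ≤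
      2 * L * 𝔑.E (fun ω => 𝔑.ind e ω * 𝔑.M v (𝔑.W ω)) :=
    mul_le_mul_of_nonneg_left hMid (by linarith)
  have h2 : L ^ 2 * 𝔑.E (𝔑.ind e) ≤ L ^ 2 * ((1 + 𝔑.η) * 𝔑.P e) :=
    mul_le_mul_of_nonneg_left hI (sq_nonneg L)
  have hid : (1 + 𝔑.η) * (𝔑.P e / 𝔑.p v ^ 2) * (d ^ 2 + B') -
      2 * L * ((1 - 𝔑.η) * (𝔑.P e / 𝔑.p v) * d) + L ^ 2 * ((1 + 𝔑.η) * 𝔑.P e) =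
      𝔑.P e / 𝔑.p v ^ 2 * (4 * 𝔑.η * d ^ 2 + (1 + 𝔑.η) * B') := by
    rw [hL, div_pow]
    field_simp
    ring
  have htail := variance_tail (θi := 𝔑.θ⁻¹) hPe hpv hd0 (𝔑.hdeg v) (𝔑.normDegree_le v)
    (by rw [one_div]; exact inv_anti₀ 𝔑.hθ0 (𝔑.hθκ.trans (𝔑.hpκ v))) hθi 𝔑.hη0 𝔑.η_le_one
    𝔑.hδ 𝔑.hs 𝔑.hr
  rw [← hB'] at htail
  have hζ : 𝔑.P e * 𝔑.ζ = 𝔑.P e * (4 * 𝔑.η * 𝔑.D ^ 2 + 2 * 𝔑.θ⁻¹ ^ 3 * 𝔑.δ * 𝔑.D * (2 * 𝔑.s + 𝔑.r) +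
      2 * 𝔑.θ⁻¹ ^ 4 * 𝔑.δ ^ 2 * 𝔑.s * (𝔑.s + 𝔑.r)) := by rw [ζ]
  rw [hζ]
  linarith

end Moments

end NibbleData

end FGKMTCovering

end Literature.Combinatorics.Hypergraph
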